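import Summits.PneNP.PneNP.Theorems.SymmetryBudgetNoHiddenOrderCertifiedSchemeDefs

/-!
# Certified labels over an abstract canonisation process — soundness and completeness

Route `PneNP/SymmetryBudget`, item `NoHiddenOrder` (stmt-PneNP-14781); memo ANALYSIS-4 §2; definitions
in `SymmetryBudgetNoHiddenOrderCertifiedSchemeDefs.lean`.

* `val_sound` — **soundness is unconditional**: for ANY decoding map, if group `L` outputs a value then
  `L` decodes to an instance and the value is a correct value (ordered copy) of that instance.  (This is
  what certification buys: a parent never consumes the value of a mis-decoded label.)
* `val_complete` — **completeness criterion**: if along the solution subtree of a legal selector with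
  values `< g` every label decodes correctly, selected vertices are fresh, children keep the vertex set
  and labels are admissible, then every group of the solution subtree outputs a value — in particular
  the root group, whose value is then a canonical form.  In the memo the hypotheses are discharged by:
  decoding = replay and values = pass-over heights (`CertifiedLabels.PassOverPath.eq_of_height_le`),
  admissibility from `height_succ_le_card`, `AdviceEntropy.factorial_le_prod_factorial_mul_two_pow`
  and the min-leaf bound `CertifiedLabels.AOTree.pathCost_le_leaves` against the Corneil–Goldberg
  tree-size theorem.

Mathlib + the Defs file only; supports stmt-PneNP-14781 (does not close it).
-/

-- `Summit.PneNP.PneNP.…` duplicates `PneNP` BY DESIGN (single-problem summit, D-0017 layout).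
set_option linter.dupNamespace false

namespace Summit.PneNP.PneNP.Theorems

namespace CertifiedLabels

open Finset

variable {W : Type*} [DecidableEq W] (P : Process W) {Val : Type*} [DecidableEq Val]
  (V : Valuation P Val) (dec : Label W → Option P.Inst) (adm : Label W → Prop) (g : ℕ)

/-- **Soundness (unconditional).**  Whatever the decoding map is: if group `L` outputs a value, then `L`
decodes to an instance and the value is a correct one (an ordered copy) of THAT instance. -/
theorem val_sound [Fintype W] (L : Label W) (v : Val) (h : val P V dec adm g L = some v) :
    ∃ I, dec L = some I ∧ V.Good I v := by
  induction hn : L.measure using Nat.strong_induction_on generalizing L v with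
  | _ n ih =>
  rw [val] at h
  split at h
  · exact absurd h (by simp)
  · rename_i I hD
    refine ⟨I, hD, ?_⟩
    split at h
    · -- leaf
      rename_i hstep
      cases h
      exact V.good_leaf I hstep
    · -- section node
      rename_i ps hstep
      dsimp only at h
      split_ifs at h with hall
      cases h
      refine V.good_paste I ps _ hstep fun J hJ => ?_
      have hJsome := hall J hJ
      by_cases hJU : P.verts J ⊂ L.U
      · rw [dif_pos hJU] at hJsome ⊢
        split_ifs at hJsome ⊢ with hdecJ
        · obtain ⟨w, hw⟩ := Option.isSome_iff_exists.1 hJsome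
          rw [hw, Option.getD_some]
          obtain ⟨I', hI', hgood⟩ :=
            ih _ (hn ▸ Label.measure_part_lt L hJU) (L.part (P.verts J)) w hw rfl
          rw [hdecJ] at hI'
          cases hI'
          exact hgood
        · simp at hJsome
      · rw [dif_neg hJU] at hJsome
        simp at hJsome
    · -- individualisation node
      rename_i A ch hstep
      have hmem := V.pick_mem _ _ h
      simp only [mem_biUnion, mem_attach, true_and, Subtype.exists, mem_filter, mem_range] at hmem
      obtain ⟨x, ⟨hxA, hxX⟩, v', hv', hv⟩ := hmem
      split_ifs at hv with hcond
      · rw [Option.mem_toFinset, Option.mem_def, Option.map_eq_some_iff] at hv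
        obtain ⟨w, hw, rfl⟩ := hv
        obtain ⟨I', hI', hgood⟩ :=
          ih _ (hn ▸ Label.measure_cand_lt L hxX v') (L.cand x v') w hw rfl
        rw [hcond.2] at hI'
        cases hI'
        exact V.good_lift I A ch x w hstep hxA hgood
      · simp at hv

/-- **Completeness criterion.**  If along the solution subtree of `sel` (a legal selector) with values
`hv < g` every label DECODES CORRECTLY (`hdec`), the selected vertex is always fresh (`hfresh`),
children keep the vertex set (`hverts`) and the labels are admissible (`hadm`), then every group on
the solution subtree — in particular the root group — outputs a value. -/
theorem val_complete [Fintype W] (sel : P.Inst → W) (hv : P.Inst → ℕ) (I₀ : P.Inst)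
    (hsel : ∀ I A ch, P.step I = .orNode A ch → sel I ∈ A)
    (hvg : ∀ I A ch, P.step I = .orNode A ch → hv I < g)
    (hverts : ∀ I A ch, P.step I = .orNode A ch → P.verts (ch (sel I)) = P.verts I)
    (hdec : ∀ I X lam, Reach P sel hv I₀ I X lam → dec ⟨P.verts I, X, lam⟩ = some I)
    (hfresh : ∀ I X lam A ch, Reach P sel hv I₀ I X lam → P.step I = .orNode A ch → sel I ∉ X)
    (hadm : ∀ I X lam, Reach P sel hv I₀ I X lam → adm ⟨P.verts I, X, lam⟩) :
    ∀ I X lam, Reach P sel hv I₀ I X lam → val P V dec adm g ⟨P.verts I, X, lam⟩ ≠ none := by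
  suffices key : ∀ n I X lam, (⟨P.verts I, X, lam⟩ : Label W).measure = n →
      Reach P sel hv I₀ I X lam → val P V dec adm g ⟨P.verts I, X, lam⟩ ≠ none from
    fun I X lam hR => key _ I X lam rfl hR
  intro n
  induction n using Nat.strong_induction_on with
  | _ n ih =>
  intro I X lam hn hR
  rw [val]
  split
  · rename_i hD
    rw [hdec I X lam hR] at hD
    cases hD
  · rename_i I' hD
    rw [hdec I X lam hR] at hD
    cases hD
    split
    · simp
    · -- section node: every part is certified and valued
      rename_i ps hstep
      dsimp only
      rw [if_pos]
      · simp
      intro J hJ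
      have hJU : P.verts J ⊂ P.verts I := P.parts_ssubset I ps hstep J hJ
      rw [dif_pos hJU]
      have hRJ : Reach P sel hv I₀ J X lam := Reach.part hR hstep hJ
      have hdJ : dec ((⟨P.verts I, X, lam⟩ : Label W).part (P.verts J)) = some J := hdec J X lam hRJ
      rw [if_pos hdJ]
      have hlt := Label.measure_part_lt (⟨P.verts I, X, lam⟩ : Label W) hJU
      have := ih _ (hn ▸ hlt) J X lam rfl hRJ
      exact Option.ne_none_iff_isSome.1 this
    · -- individualisation node: the selected child's candidate is certified and valued
      rename_i A ch hstep
      apply V.pick_ne_none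
      set L : Label W := ⟨P.verts I, X, lam⟩ with hL
      have hx : sel I ∈ A.filter fun x => x ∉ L.X :=
        mem_filter.2 ⟨hsel I A ch hstep, hfresh I X lam A ch hR hstep⟩
      have hRc : Reach P sel hv I₀ (ch (sel I)) (insert (sel I) X) (Function.update lam (sel I) (hv I)) :=
        Reach.child hR hstep
      have hcand : L.cand (sel I) (hv I) =
          ⟨P.verts (ch (sel I)), insert (sel I) X, Function.update lam (sel I) (hv I)⟩ := by
        simp [Label.cand, hL, hverts I A ch hstep]
      have hdc : dec (L.cand (sel I) (hv I)) = some (ch (sel I)) := by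
        rw [hcand]; exact hdec _ _ _ hRc
      have hac : adm (L.cand (sel I) (hv I)) := by rw [hcand]; exact hadm _ _ _ hRc
      have hlt : (L.cand (sel I) (hv I)).measure < n :=
        hn ▸ Label.measure_cand_lt L (hfresh I X lam A ch hR hstep) (hv I)
      have hvc : val P V dec adm g (L.cand (sel I) (hv I)) ≠ none := by
        rw [hcand] at hlt ⊢
        exact ih _ hlt _ _ _ rfl hRc
      obtain ⟨w, hw⟩ := Option.ne_none_iff_exists'.1 hvc
      refine ⟨V.lift I (sel I) w, ?_⟩
      simp only [mem_biUnion, mem_attach, true_and, Subtype.exists, mem_range]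
      refine ⟨sel I, hx, hv I, hvg I A ch hstep, ?_⟩
      rw [if_pos ⟨hac, hdc⟩, Option.mem_toFinset, Option.mem_def, hw]
      rfl

end CertifiedLabels

end Summit.PneNP.PneNP.Theorems
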